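import Literature.AlgebraicTopology.SingularHomology.BoundaryTransfer
import Literature.AlgebraicTopology.SingularHomology.LocalDegreeSign
import HarnessLib

/-!
# Local families of homology classes: consistency, transport along open embeddings, signs

A. Hatcher, *Algebraic Topology* (2002), §3.3, pp. 233–236: an `R`-orientation of a manifold is a
choice of generators `μₓ ∈ Hₙ(M | x; R)` which is *locally consistent* — near each point the `μ_y`
are the restrictions of one class along a ball (Lemma 3.27 ff.); local orientations are natural
under homeomorphisms onto open subsets (p. 231, excision `Hₙ(U | x) ≅ Hₙ(M | x)`).

This file isolates the bookkeeping of such **local families** `β : (z : X) → Hₖ(X | z; M)`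
(total functions; values off the region of interest are junk), as used to ASSEMBLE an orientation
from pieces (orienting a manifold glued from two oriented open pieces along a connected overlap):

* `LocalFamily.ConsistentOn β N` — `∃ m ∈ Hₖ(X | N), m|_z = β z` for all `z ∈ N`; `mono`;
* `ConsistentOn.image` — push-forward along an injective map `j` (`β (j z') = j_* β' z'`);
* `ConsistentOn.preimage_of_isOpenEmbedding` — pull-back along an open embedding `j` onto a
  neighbourhood of `closure (j K')` (set-level excision `localHomologyOfSet.openSubsetIso`);
* `consistentOn_relToLocal` — the local images `z ↦ w|_z` of a relative class `w ∈ Hₖ(X, B)` are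
  consistent on every `K ⊆ X ∖ B`;
* `ConsistentOn.eventually_eq` — on a space charted over a proper normed space, two families
  consistent near `x` and equal at `x` agree near `x` (chart balls, Hatcher p. 234:
  `exists_isOpen_isIso_restrictToPoint`);
* `eqOn_of_isPreconnected_of_smul` — if `β' = ε • β` pointwise on a preconnected open set `O` with
  `β` generators and both families locally consistent on `O`, the sign `ε` is constant on `O`;
* `HomologicalOrientation.ofLocalFamily` — a family of generators, locally consistent near every
  point, is an orientation (repackaging of the definition).

Everything is proved; no named facts.

## References

* A. Hatcher, *Algebraic Topology*, CUP 2002, §3.3 pp. 231–236, Lemma 3.27. [HatcherAT2002]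
-/

noncomputable section

open CategoryTheory Limits Topology Set Function Filter

universe u v

namespace Literature.AlgebraicTopology.SingularHomology

variable (R : Type v) [CommRing R] (M : Type v) [AddCommGroup M] [Module R M]
variable {X X' : Type u} [TopologicalSpace X] [TopologicalSpace X']

/-- A **local family** of degree-`k` classes on `X`: a class in `Hₖ(X | z; M)` at every point
(Hatcher 2002, §3.3 p. 233: "a function `x ↦ μₓ`"). [cite: HatcherAT2002, §3.3 p. 233] -/
abbrev LocalFamily (X : Type u) [TopologicalSpace X] (k : ℕ) : Type _ :=
  ∀ z : X, localHomology R M X z k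

variable {R M}

namespace LocalFamily

variable {k : ℕ}

/-- **Local consistency of a family on a set `N`**: the classes `β z`, `z ∈ N`, are the restrictions
of one class along `N` (Hatcher 2002, §3.3 p. 233, the local consistency condition).
[cite: HatcherAT2002, §3.3 p. 233] -/
def ConsistentOn (β : LocalFamily R M X k) (N : Set X) : Prop :=
  ∃ m : localHomologyOfSet R M X N k, ∀ (z : X) (hz : z ∈ N), restrictToPoint R M hz k m = β z

/-- Consistency passes to subsets. [folklore] -/
theorem ConsistentOn.mono {β : LocalFamily R M X k} {N N' : Set X} (h : β.ConsistentOn N)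
    (hN : N' ⊆ N) : β.ConsistentOn N' := by
  obtain ⟨m, hm⟩ := h
  refine ⟨restrictLocal R M hN k m, fun z hz => ?_⟩
  rw [restrictToPoint_restrictLocal_apply, hm z (hN hz)]

/-- Restriction to a point commutes with push-forward along a map of pairs (elementwise).
[folklore] -/
theorem restrictToPoint_map_apply (f : C(X', X)) {K : Set X'} {L : Set X} (hKL : MapsTo f Kᶜ Lᶜ)
    {a : X'} {b : X} (ha : a ∈ K) (hb : b ∈ L) (hab : MapsTo f ({a}ᶜ : Set X') ({b}ᶜ : Set X))
    (m : localHomologyOfSet R M X' K k) :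
    restrictToPoint R M hb k (relativeSingularHomology.map R M f hKL k m) =
      relativeSingularHomology.map R M f hab k (restrictToPoint R M ha k m) := by
  change (relativeSingularHomology.map R M f hKL k ≫ restrictToPoint R M hb k) m =
    (restrictToPoint R M ha k ≫ relativeSingularHomology.map R M f hab k) m
  rw [restrictToPoint, restrictLocal, restrictToPoint, restrictLocal,
    ← relativeSingularHomology.map_comp, ← relativeSingularHomology.map_comp]
  rfl

omit [TopologicalSpace X] [TopologicalSpace X'] in
/-- An injective map is a map of pairs `(X', X' ∖ N') → (X, X ∖ j(N'))`. [folklore] -/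
theorem mapsTo_compl_image {j : X' → X} (hj : Injective j) (N' : Set X') :
    MapsTo j N'ᶜ (j '' N')ᶜ := fun _ hz ⟨_, hy, hyz⟩ => hz (hj hyz ▸ hy)

omit [TopologicalSpace X] [TopologicalSpace X'] in
/-- An injective map is a map of pairs `(X', X' ∖ z') → (X, X ∖ j z')`. [folklore] -/
theorem mapsTo_compl_pt {j : X' → X} (hj : Injective j) (z' : X') :
    MapsTo j ({z'}ᶜ : Set X') ({j z'}ᶜ : Set X) := fun _ hz h => hz (hj h)

/-- **Push-forward of a consistent family along an injective map.** If `β'` is consistent on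
`N'` and `β (j z') = j_* (β' z')` for `z' ∈ N'`, then `β` is consistent on `j(N')`. [folklore] -/
theorem ConsistentOn.image {β' : LocalFamily R M X' k} {β : LocalFamily R M X k} (j : C(X', X))
    (hj : Injective j) {N' : Set X'} (h : β'.ConsistentOn N')
    (hβ : ∀ z' ∈ N', β (j z') =
      relativeSingularHomology.map R M j (mapsTo_compl_pt hj z') k (β' z')) :
    β.ConsistentOn (j '' N') := by
  obtain ⟨m', hm'⟩ := h
  refine ⟨relativeSingularHomology.map R M j (mapsTo_compl_image hj N') k m', ?_⟩
  rintro _ ⟨z', hz', rfl⟩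
  rw [restrictToPoint_map_apply j (mapsTo_compl_image hj N') hz' (mem_image_of_mem j hz')
    (mapsTo_compl_pt hj z'), hm' z' hz', hβ z' hz']

/-- **Pull-back of a consistent family along an open embedding.** Let `j : X' → X` be an open
embedding, `K' ⊆ X'` with `closure (j K') ⊆ range j` (e.g. `K'` compact and `X` Hausdorff), `β`
consistent on `j(K')` with `β (j z') = j_* (β' z')` on `K'`. Then `β'` is consistent on `K'`
(excision `Hₖ(range j | jK') ≅ Hₖ(X | jK')`, Hatcher 2002, Thm. 2.20, and the homeomorphism
`X' ≅ range j`). [cite: HatcherAT2002, §3.3 p. 231] -/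
theorem ConsistentOn.preimage_of_isOpenEmbedding [T1Space X] {β' : LocalFamily R M X' k}
    {β : LocalFamily R M X k} (j : C(X', X)) (hj : IsOpenEmbedding j) {K' : Set X'} (hcl : closure (j '' K') ⊆ range j)
    (h : β.ConsistentOn (j '' K'))
    (hβ : ∀ z' ∈ K', β (j z') =
      relativeSingularHomology.map R M j (mapsTo_compl_pt hj.injective z') k (β' z')) :
    β'.ConsistentOn K' := by
  obtain ⟨m, hm⟩ := h
  -- excision to the open subspace `range j`, then transport along `X' ≃ₜ range j`
  let e : X' ≃ₜ ↥(range j) := hj.isEmbedding.toHomeomorph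
  have he : ∀ z', (e z' : X) = j z' := fun z' => rfl
  have hpre : (e.symm : C(↥(range j), X')) ⁻¹' K' = Subtype.val ⁻¹' (j '' K') := by
    ext w
    constructor
    · intro hw
      refine ⟨e.symm w, hw, ?_⟩
      rw [← he, e.apply_symm_apply]
    · rintro ⟨z', hz', hzw⟩
      have : e.symm w = z' := by
        rw [Homeomorph.symm_apply_eq]
        exact Subtype.ext (hzw.symm.trans (he z').symm)
      show e.symm w ∈ K'
      rwa [this]
  have hms : MapsTo (e.symm : C(↥(range j), X')) (Subtype.val ⁻¹' (j '' K'))ᶜ K'ᶜ := by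
    intro w hw hw'
    apply hw
    rw [← hpre]
    exact hw'
  set mO := (localHomologyOfSet.openSubsetIso R M hj.isOpen_range hcl k).inv m with hmO
  refine ⟨relativeSingularHomology.map R M (e.symm : C(↥(range j), X')) hms k mO, fun z' hz' => ?_⟩
  -- `j_* (e.symm_* mO) = m`
  have hcomp : (j : C(X', X)).comp (e.symm : C(↥(range j), X')) = subsetIncl (range j) := by
    ext w
    change j (e.symm w) = (w : X)
    rw [← he, e.apply_symm_apply]
  have hkey : relativeSingularHomology.map R M j (mapsTo_compl_image hj.injective K') k
      (relativeSingularHomology.map R M (e.symm : C(↥(range j), X')) hms k mO) = m := by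
    rw [← ModuleCat.comp_apply, ← relativeSingularHomology.map_comp,
      relativeSingularHomology.map.congr_simp R M _ _ hcomp
        ((mapsTo_compl_image hj.injective K').comp hms) k]
    change (localHomologyOfSet.openSubsetIso R M hj.isOpen_range hcl k).hom mO = m
    rw [hmO, ← ModuleCat.comp_apply, Iso.inv_hom_id, ModuleCat.id_apply]
  -- compare after `j_*`, injective on `Hₖ(X' | z')`
  haveI := localHomology.isIso_map_of_isOpenEmbedding_of_eq R M j hj z' rfl k
  apply (ModuleCat.mono_iff_injective
    (relativeSingularHomology.map R M j (mapsTo_compl_pt hj.injective z') k)).1 inferInstance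
  rw [← hβ z' hz', ← hm (j z') (mem_image_of_mem j hz'),
    ← restrictToPoint_map_apply j (mapsTo_compl_image hj.injective K') hz'
      (mem_image_of_mem j hz') (mapsTo_compl_pt hj.injective z'), hkey]

end LocalFamily

/-! ### The family of local images of a relative class -/

open Classical in
/-- The local family of a relative class `w ∈ Hₖ(X, B; M)`: `z ↦ w|_z` on `X ∖ B` (zero on `B`).
[folklore] -/
def relLocalFamily {B : Set X} {k : ℕ} (w : relativeSingularHomology R M X B k) : LocalFamily R M X k :=
  fun z => if hz : z ∈ Bᶜ then relativeSingularHomology.toLocal R M B ⟨z, hz⟩ k w else 0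

/-- Values of the local family of a relative class off `B`. [folklore] -/
theorem relLocalFamily_apply {B : Set X} {k : ℕ} (w : relativeSingularHomology R M X B k) {z : X}
    (hz : z ∈ Bᶜ) : relLocalFamily w z = relativeSingularHomology.toLocal R M B ⟨z, hz⟩ k w := by
  unfold relLocalFamily
  rw [dif_pos hz]

/-- **The local images of a relative class are consistent** on every `K ⊆ X ∖ B` (they are the
restrictions of the image of `w` in `Hₖ(X | K)`). [folklore] -/
theorem consistentOn_relLocalFamily {B K : Set X} {k : ℕ} (w : relativeSingularHomology R M X B k)
    (hK : K ⊆ Bᶜ) : (relLocalFamily w).ConsistentOn K := by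
  have hBK : MapsTo (ContinuousMap.id X) B Kᶜ := fun z hz hzK => hK hzK hz
  refine ⟨relativeSingularHomology.map R M (ContinuousMap.id X) hBK k w, fun z hz => ?_⟩
  rw [relLocalFamily_apply w (hK hz)]
  change (relativeSingularHomology.map R M (ContinuousMap.id X) hBK k ≫ restrictToPoint R M hz k) w = _
  rw [restrictToPoint, restrictLocal, ← relativeSingularHomology.map_comp]
  rfl

/-! ### Agreement near a point; constancy of signs on connected sets -/

namespace LocalFamily

variable {k : ℕ}

section ChartBall

variable [T2Space X] (E : Type*) [NormedAddCommGroup E] [NormedSpace ℝ E] [ProperSpace E]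
  [ChartedSpace E X]

include E in
/-- **Two families consistent near `x` and equal at `x` agree near `x`** (on a chart ball `B`
about `x` the restriction `Hₖ(X | B) → Hₖ(X | x)` is an isomorphism, Hatcher 2002, §3.3 p. 234).
[cite: HatcherAT2002, §3.3 p. 234] -/
theorem ConsistentOn.eventually_eq {β β' : LocalFamily R M X k} {x : X} {N : Set X} (hN : N ∈ 𝓝 x)
    (hβ : β.ConsistentOn N) (hβ' : β'.ConsistentOn N) (hx : β x = β' x) :
    ∀ᶠ y in 𝓝 x, β y = β' y := by
  obtain ⟨B, hxB, hBo, hBN, hiso⟩ := exists_isOpen_isIso_restrictToPoint R M E x hN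
  obtain ⟨m, hm⟩ := hβ.mono hBN
  obtain ⟨m', hm'⟩ := hβ'.mono hBN
  haveI := hiso k
  have hmm' : m = m' := by
    apply (ModuleCat.mono_iff_injective (restrictToPoint R M hxB k)).1 inferInstance
    rw [hm x hxB, hm' x hxB, hx]
  filter_upwards [hBo.mem_nhds hxB] with y hy
  rw [← hm y hy, ← hm' y hy, hmm']

include E in
/-- **Signs between two locally consistent families of generators are locally constant**: if on an
open set `O` both `β` and `β'` are consistent near every point, `β z` generates `Hₖ(X | z) ≅ R` and
`β' z = ε z • β z` for `z ∈ O`, then `ε` is locally constant on `O`. [folklore] -/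
theorem eventually_sign_eq {β β' : LocalFamily R R X k} {O : Set X} (hO : IsOpen O)
    (hβ : ∀ x ∈ O, ∃ N ∈ 𝓝 x, β.ConsistentOn N) (hβ' : ∀ x ∈ O, ∃ N ∈ 𝓝 x, β'.ConsistentOn N)
    (hgen : ∀ x ∈ O, ∃ e : localHomology R R X x k ≃ₗ[R] R, e (β x) = 1)
    {ε : X → Rˣ} (hε : ∀ x ∈ O, β' x = (ε x : R) • β x) {x : X} (hx : x ∈ O) :
    ∀ᶠ y in 𝓝 x, ε y = ε x := by
  obtain ⟨N, hN, hN'⟩ := hβ x hx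
  obtain ⟨N₁, hN₁, hN₁'⟩ := hβ' x hx
  -- the families `ε x • β` and `β'` are consistent near `x` and agree at `x`
  have h1 : LocalFamily.ConsistentOn (fun z => (ε x : R) • β z : LocalFamily R R X k) (N ∩ N₁) := by
    obtain ⟨m, hm⟩ := hN'.mono inter_subset_left
    exact ⟨(ε x : R) • m, fun z hz => by rw [map_smul, hm z hz]⟩
  have h2 := ConsistentOn.eventually_eq E (β := fun z => (ε x : R) • β z) (β' := β')
    (inter_mem hN hN₁) h1 (hN₁'.mono inter_subset_right) (by simp only [hε x hx])
  filter_upwards [h2, hO.mem_nhds hx] with y hy hyO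
  have hy' : (ε x : R) • β y = (ε y : R) • β y := by rw [← hε y hyO]; exact hy
  obtain ⟨e, he⟩ := hgen y hyO
  have h3 := congrArg e hy'
  simp only [LinearEquiv.map_smul, he, smul_eq_mul, mul_one] at h3
  exact (Units.ext h3).symm

include E in
/-- **On a preconnected open set the sign is constant.** [folklore] -/
theorem sign_eq_of_isPreconnected {β β' : LocalFamily R R X k} {O : Set X} (hO : IsOpen O)
    (hOc : IsPreconnected O)
    (hβ : ∀ x ∈ O, ∃ N ∈ 𝓝 x, β.ConsistentOn N) (hβ' : ∀ x ∈ O, ∃ N ∈ 𝓝 x, β'.ConsistentOn N)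
    (hgen : ∀ x ∈ O, ∃ e : localHomology R R X x k ≃ₗ[R] R, e (β x) = 1)
    {ε : X → Rˣ} (hε : ∀ x ∈ O, β' x = (ε x : R) • β x) {x y : X} (hx : x ∈ O) (hy : y ∈ O) :
    ε x = ε y := by
  classical
  -- the indicator of `{ε = ε x}` is continuous on `O` into `Bool` (discrete)
  let f : X → Bool := fun z => decide (ε z = ε x)
  have hf : ContinuousOn f O := by
    intro z hz
    have hev := eventually_sign_eq E hO hβ hβ' hgen hε hz
    have : Tendsto f (𝓝[O] z) (pure (f z)) := by
      rw [tendsto_pure]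
      refine (hev.filter_mono nhdsWithin_le_nhds).mono fun w hw => ?_
      simp only [f, hw]
    exact this.mono_right (pure_le_nhds _)
  have h := hOc.constant hf hy hx
  change decide (ε y = ε x) = decide (ε x = ε x) at h
  rw [decide_eq_true (rfl : ε x = ε x)] at h
  exact (of_decide_eq_true h).symm

end ChartBall

end LocalFamily

/-! ### An orientation from a locally consistent family of generators -/

/-- **A locally consistent family of generators is an orientation** (Hatcher 2002, §3.3 p. 233,
the definition, repackaged for families). [cite: HatcherAT2002, §3.3 p. 233] -/
def HomologicalOrientation.ofLocalFamily {n : ℕ} (β : LocalFamily R R X n)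
    (hgen : ∀ x, ∃ e : localHomology R R X x n ≃ₗ[R] R, e (β x) = 1)
    (hcons : ∀ x, ∃ N ∈ 𝓝 x, β.ConsistentOn N) : HomologicalOrientation R X n where
  localClass := β
  isGenerator := hgen
  locallyConsistent x := by
    obtain ⟨N, hN, m, hm⟩ := hcons x
    exact ⟨N, hN, m, hm⟩

/-- The local classes of `ofLocalFamily`. [folklore] -/
@[simp] theorem HomologicalOrientation.ofLocalFamily_localClass {n : ℕ} (β : LocalFamily R R X n)
    (hgen : ∀ x, ∃ e : localHomology R R X x n ≃ₗ[R] R, e (β x) = 1)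
    (hcons : ∀ x, ∃ N ∈ 𝓝 x, β.ConsistentOn N) (x : X) :
    (HomologicalOrientation.ofLocalFamily β hgen hcons).localClass x = β x := rfl

/-- The local classes of an orientation form a family consistent near every point. [folklore] -/
theorem HomologicalOrientation.consistentOn_nhds {n : ℕ} (μ : HomologicalOrientation R X n) (x : X) :
    ∃ N ∈ 𝓝 x, LocalFamily.ConsistentOn (μ.localClass : LocalFamily R R X n) N := by
  obtain ⟨K, hK, μK, hμK⟩ := μ.locallyConsistent x
  exact ⟨K, hK, μK, hμK⟩

end Literature.AlgebraicTopology.SingularHomology
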